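import Literature.AlgebraicGeometry.Resolution.PointBlowupFlagTangentBound

/-!
# Hauser–Perlega §4 in fixed coordinates, I: the translated point blow-up is the monomial blow-up of the sheared
# expansion (`F′(x,y) = x^{−pᵉ}·F_t(x, xy)`) and the Newton-polygon bound `d′_res ≤ d_t` (Figure 1)

H. Hauser, S. Perlega, *Resolving surface singularities in positive characteristic*, Publ. RIMS Kyoto Univ. **60**
(2024) 767–813 [cite: HauserPerlega2024], §4 pp. 779–780: "we may assume that the map `𝒪̂_{W,a} → 𝒪̂_{W′,a′}` is of
the form `x ↦ x, y ↦ x(y + t), z ↦ xz` and `X′` is defined at `a′` by the element `f′ = z^{pᵉ} + F′(x,y)`, where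
`F′(x,y) = x^{−pᵉ} F(x, x(y + t))` … Now consider the change of parameters `y_t = y + tx` in `𝒪̂_{W,a}`. The expansion
of `F` with respect to the parameters `x, y_t` is in general not clean. Let `f = z_t^{pᵉ} + F_t(x, y_t)` be the
cleaned expansion … the local ring map `𝒪̂_{W,a} → 𝒪̂_{W′,a′}` is of the form `x ↦ x, y_t ↦ xy, z_t ↦ xz′_t`. Hence,
`F′_t(x,y) = x^{−pᵉ} F_t(x, xy)` and `F_t(x,y)` are related to each other by a monomial substitution of the
parameters. … Let `in(F_t)` denote the initial form of `F_t` and let `d_t` be the order of `in(F_t)` along the curve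
`V(z, y)`. Figure 1 shows how the Newton polygons of `F_t` and `F′_t` as well as `d_t` and `d′_res` are related. We
see that the inequality `d′_res ≤ d_t` holds."

This file proves these statements in the atlas model of `PointBlowupShade` / `PointBlowupFlagInvariant` (two letters
`x` = the chart letter and `y`; states `s = (F, r)`; `step q x b s` = chart transform, translation to the point
`b = (0, t)` of the exceptional divisor, deletion of the `q`-th power monomials; flags in the triangular presentation
`FlagDatum`), for EVERY field `K` and every natural number `q` (no characteristic hypothesis):

* §1 `translate_chartTransform_eq_chartTransform_shear` — TRANSLATED CHART = CHART OF THE SHEAR: for `b_x = 0`,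
  `translate b (chartTransform q x F) = chartTransform q x (F(x, y + b_y·x))`, an exact polynomial identity (both
  sides are `x^{a+c−q}(y + t)^c` on the monomial `x^a y^c`); the chart transform is additive (`chartTransform_add`).
* §2 `coeff_shear_eq_sum` / `coeff_shear_eq_coeff_of_unique` (coefficients of the shear; a monomial with a unique
  contributor keeps its coefficient), `ordZero_cleanShear_eq` (`ord F_t = ord F` for a clean `F`), and
  `step_F_eq_chartTransform_clean_shear` — for `q ≤ ord F`: `(step q x b s).F = chartTransform q x F₀` with
  `F₀ = deletePthPowers q (F(x, y + t x))` the CLEAN SHEARED EXPANSION (cleaning commutes with the chart,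
  `deletePthPowers_chartTransform`), and `expansion_shearFlag_eq_coe` — `F₀` is the coercion of the clean expansion
  `Φ_t.expansion q F` of the flag `Φ_t = ⟨y, x, −t·X⟩` (`F₁ = V(z_t, y + t x)`; the paper's `y₀ = y − tx` with
  `t ↦ −t`), so that the flag invariants of [HP24, §5] at `a` computed from `Φ_t` and the residual data at `a′`
  computed from `(step q x b s).F` speak about ONE polynomial `F₀`.
* §3 `ordVar_chartTransform_self` (`ord_x F′ = ord F₀ − q`), `ordVar_cleanShear_self` (`ord_x F_t = ord_x F`),
  `dRes_chartTransform_le` — FIGURE 1: for every monomial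
  `x^{o−j} y^j` of least degree `o` of `F₀`, `dRes {x} (chartTransform q x F₀) ≤ j`; and
  `exists_mem_support_apply_eq_ordAlong_initialPart` — `d_t = ord_{(y)} in(F₀)` (the series-level `ordAlong`/`initialPart`
  of `PointBlowupFlagInvariant`, i.e. `d^curv` of a flag with `n = 1`) is the least such `j` and is attained.

Sequel: `PointBlowupFlagLostComponents` (terminal readings and [HP24, Prop. 4] case (ii)); the dictionary is also the
first step of case (iv).  Elementary support bookkeeping; nothing beyond the quoted lines is claimed.
-/

noncomputable section

open MvPolynomial Finset
open scoped BigOperators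

namespace Literature.AlgebraicGeometry.Resolution

open Literature.AlgebraicGeometry.Resolution.Hauser2010
open Literature.AlgebraicGeometry.Resolution.PointBlowup
open Literature.AlgebraicGeometry.Resolution.HauserWagner2014
open Literature.AlgebraicGeometry.Resolution.WeightedBlowup
open Literature.Barriers.ResolutionOfSingularities

namespace HauserPerlega2024

/-! ## 0. Two letters -/

section Unfold

variable {σ : Type*} {K : Type*} [Field K]

open scoped Classical in
/-- unfolding the cleaning (classical decidability, as in the definition). [folklore] -/
private theorem cleanSeries_apply' (q : ℕ) (H : MvPowerSeries σ K) (d : σ →₀ ℕ) :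
    cleanSeries q H d = if ∀ i, q ∣ d i then 0 else H d := rfl

/-- unfolding the weighted initial form. [folklore] -/
private theorem initialPart_apply' (ω : σ → ℕ) (H : MvPowerSeries σ K) (d : σ →₀ ℕ) :
    initialPart ω H d = if ((Finsupp.weight ω d : ℕ) : ℕ∞) = wOrder ω H then H d else 0 := rfl

end Unfold

section TwoLetters

variable {σ : Type*}

/-- two letters: `univ = {x, y}`. [folklore] -/
private theorem univ_eq_pair_of_two [Fintype σ] [DecidableEq σ] {x y : σ} (hσ : ∀ l, l = x ∨ l = y) :
    (Finset.univ : Finset σ) = {x, y} := by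
  ext l
  simp only [Finset.mem_univ, Finset.mem_insert, Finset.mem_singleton, true_iff]
  exact hσ l

/-- two letters: a sum over all letters has two terms. [folklore] -/
private theorem sum_letters_two [Fintype σ] [DecidableEq σ] {M : Type*} [AddCommMonoid M] {x y : σ} (hxy : x ≠ y)
    (hσ : ∀ l, l = x ∨ l = y) (f : σ → M) : ∑ l, f l = f x + f y := by
  rw [univ_eq_pair_of_two hσ, Finset.sum_pair hxy]

/-- two letters: a product over all letters has two factors. [folklore] -/
private theorem prod_letters_two [Fintype σ] [DecidableEq σ] {M : Type*} [CommMonoid M] {x y : σ} (hxy : x ≠ y)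
    (hσ : ∀ l, l = x ∨ l = y) (f : σ → M) : ∏ l, f l = f x * f y := by
  rw [univ_eq_pair_of_two hσ, Finset.prod_pair hxy]

/-- Evaluation of `a·e_x + b·e_y` at `x`. [folklore] -/
private theorem single_add_single_apply_fst {x y : σ} (hxy : x ≠ y) (a b : ℕ) :
    (Finsupp.single x a + Finsupp.single y b) x = a := by
  rw [Finsupp.add_apply, Finsupp.single_eq_same, Finsupp.single_eq_of_ne hxy, add_zero]

/-- Evaluation of `a·e_x + b·e_y` at `y`. [folklore] -/
private theorem single_add_single_apply_snd {x y : σ} (hxy : x ≠ y) (a b : ℕ) :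
    (Finsupp.single x a + Finsupp.single y b) y = b := by
  rw [Finsupp.add_apply, Finsupp.single_eq_same, Finsupp.single_eq_of_ne (Ne.symm hxy), zero_add]

/-- With two letters an exponent is determined by its two entries. [cite: HauserPerlega2024, §4 p. 779 (the parameters x, y: monomials x^i y^j)] -/
theorem finsupp_eq_single_add_single {x y : σ} (hxy : x ≠ y) (hσ : ∀ l, l = x ∨ l = y) (d : σ →₀ ℕ) :
    d = Finsupp.single x (d x) + Finsupp.single y (d y) := by
  ext l
  rcases hσ l with rfl | rfl
  · rw [single_add_single_apply_fst hxy]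
  · rw [single_add_single_apply_snd hxy]

/-- With two letters the degree of an exponent is the sum of its two entries. [cite: HauserPerlega2024, §4 p. 781 (ω(g) = min{i + jn}, here n = 1: the degree i + j)] -/
theorem degree_eq_two [Fintype σ] [DecidableEq σ] {x y : σ} (hxy : x ≠ y) (hσ : ∀ l, l = x ∨ l = y) (d : σ →₀ ℕ) :
    d.degree = d x + d y := by
  have h := pkgWeight_eq_two (j := x) (i := y) (Ne.symm hxy) hσ 1 d
  rwa [pkgWeight_one, one_mul] at h

/-- The chart exponent of the `x`-chart with two letters: `(a, b) ↦ (a + b − q, b)`. [cite: Hauser2010, §F (chart expressions of a point blowup)] -/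
theorem chartExponent_two [Fintype σ] [DecidableEq σ] {x y : σ} (hxy : x ≠ y) (hσ : ∀ l, l = x ∨ l = y) (q : ℕ)
    (d : σ →₀ ℕ) : chartExponent q x d = Finsupp.single x (d x + d y - q) + Finsupp.single y (d y) := by
  ext l
  rw [chartExponent_apply]
  rcases hσ l with rfl | rfl
  · rw [if_pos rfl, single_add_single_apply_fst hxy, degree_eq_two hxy hσ]
  · rw [if_neg (Ne.symm hxy), single_add_single_apply_snd hxy]

end TwoLetters

/-! ## 1. The chart transform is additive; translated chart = chart of the shear -/

section Shear

variable {σ : Type*} {K : Type*} [Field K] [DecidableEq σ]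

omit [DecidableEq σ] in
/-- The monomials of a polynomial of order `o` have degree `≥ o`, and one has degree `o`. [cite: Hauser2010, §C (order of X at a point: the least degree of a monomial)] -/
theorem exists_mem_support_degree_eq {G : MvPolynomial σ K} {o : ℕ} (ho : ordZero G = o) :
    (∃ d ∈ G.support, d.degree = o) ∧ ∀ d ∈ G.support, o ≤ d.degree := by
  obtain ⟨⟨d, hd, hdeg⟩, hmin⟩ := (ordZero_eq_nat_iff G o).mp ho
  refine ⟨⟨d, MvPolynomial.mem_support_iff.mpr hd, hdeg⟩, fun d' hd' => ?_⟩
  by_contra hlt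
  exact (MvPolynomial.mem_support_iff.mp hd') (hmin d' (not_le.mp hlt))

/-- The chart transform summed over any finite set containing the support. [cite: Hauser2010, §F (chart expressions of a point blowup)] -/
theorem chartTransform_eq_sum_of_subset (q : ℕ) (j : σ) (F : MvPolynomial σ K) {S : Finset (σ →₀ ℕ)}
    (hS : F.support ⊆ S) : chartTransform q j F = ∑ d ∈ S, monomial (chartExponent q j d) (coeff d F) := by
  unfold chartTransform
  refine Finset.sum_subset hS fun d _ hd => ?_
  rw [MvPolynomial.notMem_support_iff.mp hd, map_zero]

/-- The chart transform is additive. [cite: Hauser2010, §F (chart expressions of a point blowup)] -/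
theorem chartTransform_add (q : ℕ) (j : σ) (F G : MvPolynomial σ K) :
    chartTransform q j (F + G) = chartTransform q j F + chartTransform q j G := by
  classical
  rw [chartTransform_eq_sum_of_subset q j (F + G) (MvPolynomial.support_add (p := F) (q := G)),
    chartTransform_eq_sum_of_subset q j F (Finset.subset_union_left (s₂ := G.support)),
    chartTransform_eq_sum_of_subset q j G (Finset.subset_union_right (s₁ := F.support)),
    ← Finset.sum_add_distrib]
  refine Finset.sum_congr rfl fun d _ => ?_
  rw [coeff_add, map_add]

/-- The chart transform of a monomial. [cite: Hauser2010, §F (chart expressions of a point blowup)] -/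
theorem chartTransform_monomial (q : ℕ) (j : σ) (d : σ →₀ ℕ) (c : K) :
    chartTransform q j (monomial d c) = monomial (chartExponent q j d) c := by
  classical
  by_cases hc : c = 0
  · subst hc
    unfold chartTransform
    simp
  · unfold chartTransform
    rw [MvPolynomial.support_monomial, if_neg hc, Finset.sum_singleton, coeff_monomial, if_pos rfl]

/-- The chart transform of zero. [cite: Hauser2010, §F (chart expressions of a point blowup)] -/
theorem chartTransform_zero (q : ℕ) (j : σ) : chartTransform q j (0 : MvPolynomial σ K) = 0 := by
  unfold chartTransform
  simp

/-- The chart transform of a finite sum. [cite: Hauser2010, §F (chart expressions of a point blowup)] -/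
theorem chartTransform_sum {ι : Type*} (q : ℕ) (j : σ) (s : Finset ι) (f : ι → MvPolynomial σ K) :
    chartTransform q j (∑ i ∈ s, f i) = ∑ i ∈ s, chartTransform q j (f i) := by
  classical
  induction s using Finset.induction_on with
  | empty => simp [chartTransform_zero]
  | insert a s ha ih => rw [Finset.sum_insert ha, Finset.sum_insert ha, chartTransform_add, ih]

omit [DecidableEq σ] in
/-- Translation is additive. [cite: Hauser2010, §F (the point a′ of the exceptional divisor; translation)] -/
theorem translate_add (b : σ → K) (F G : MvPolynomial σ K) :
    translate b (F + G) = translate b F + translate b G := by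
  unfold translate
  rw [map_add]

omit [DecidableEq σ] in
/-- Normal form of the terms of `C c · x^e · (y + t)^n`: `C c · (x^e · (y^k · (C t)^m · n)) = (c t^m n)·x^e y^k`.
[folklore] -/
private theorem C_mul_X_pow_mul_term (x y : σ) (c t : K) (e k m n : ℕ) :
    C c * (X x ^ e * (X y ^ k * C t ^ m * (n : MvPolynomial σ K))) =
      monomial (Finsupp.single x e + Finsupp.single y k) (c * t ^ m * n) := by
  rw [← map_pow, ← map_natCast (C : K →+* MvPolynomial σ K) n]
  simp only [X_pow_eq_monomial, C_apply, monomial_mul, zero_add, add_zero, one_mul, mul_assoc]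

omit [DecidableEq σ] in
/-- Normal form of the terms of `C c · x^a · (y + t x)^n`: `C c · (x^a · (y^k · (C t · x)^m · n)) = (c t^m n)·x^{a+m} y^k`.
[folklore] -/
private theorem C_mul_X_pow_mul_term' (x y : σ) (c t : K) (a k m n : ℕ) :
    C c * (X x ^ a * (X y ^ k * (C t * X x) ^ m * (n : MvPolynomial σ K))) =
      monomial (Finsupp.single x (a + m) + Finsupp.single y k) (c * t ^ m * n) := by
  rw [mul_pow, ← map_pow, ← map_natCast (C : K →+* MvPolynomial σ K) n]
  simp only [X_pow_eq_monomial, C_apply, monomial_mul, zero_add, add_zero, one_mul, mul_one, mul_assoc]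
  rw [show Finsupp.single x a + (Finsupp.single y k + Finsupp.single x m) =
    Finsupp.single x (a + m) + Finsupp.single y k by rw [Finsupp.single_add]; abel]

variable [Fintype σ]

/-- **Translated chart = chart of the shear** (two letters, chart letter `x`, point `b = (0, t)` of the exceptional
divisor): `translate b (chartTransform q x F) = chartTransform q x (F(x, y + t·x))`.  On a monomial `x^a y^c` both
sides are `Σ_k binom(c,k) t^{c−k} x^{a+c−q} y^k = x^{a+c−q}(y + t)^c`. [cite: HauserPerlega2024, §4 p. 779 (F′_t(x,y) = x^{−pᵉ} F_t(x, xy))] -/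
theorem translate_chartTransform_eq_chartTransform_shear {x y : σ} (hxy : x ≠ y) (hσ : ∀ l, l = x ∨ l = y)
    (q : ℕ) (b : σ → K) (hbx : b x = 0) (F : MvPolynomial σ K) :
    translate b (chartTransform q x F) =
      chartTransform q x (MvPolynomial.aeval
        (fun l => if l = y then (X y + C (b y) * X x : MvPolynomial σ K) else X l) F) := by
  induction F using MvPolynomial.induction_on' with
  | monomial d c =>
    -- both sides equal the binomial sum `Σ_k (c t^{d_y−k} C(d_y,k)) · x^{d_x+d_y−q} y^k`
    have hL : translate b (chartTransform q x (monomial d c)) =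
        ∑ k ∈ Finset.range (d y + 1), monomial (Finsupp.single x (d x + d y - q) + Finsupp.single y k)
          (c * b y ^ (d y - k) * ((d y).choose k : ℕ)) := by
      rw [chartTransform_monomial, translate_monomial, prod_letters_two hxy hσ, chartExponent_two hxy hσ,
        single_add_single_apply_fst hxy, single_add_single_apply_snd hxy, hbx, map_zero, add_zero, add_pow]
      simp only [Finset.mul_sum]
      refine Finset.sum_congr rfl fun k _ => ?_
      rw [C_mul_X_pow_mul_term]
    have hR : chartTransform q x (MvPolynomial.aeval
          (fun l => if l = y then (X y + C (b y) * X x : MvPolynomial σ K) else X l) (monomial d c)) =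
        ∑ k ∈ Finset.range (d y + 1), monomial (Finsupp.single x (d x + d y - q) + Finsupp.single y k)
          (c * b y ^ (d y - k) * ((d y).choose k : ℕ)) := by
      rw [MvPolynomial.aeval_monomial, Finsupp.prod_fintype _ _ (fun i => pow_zero _), prod_letters_two hxy hσ,
        if_neg hxy, if_pos rfl, MvPolynomial.algebraMap_eq, add_pow]
      simp only [Finset.mul_sum]
      rw [chartTransform_sum]
      refine Finset.sum_congr rfl fun k hk => ?_
      have hk' : k ≤ d y := Nat.lt_succ_iff.mp (Finset.mem_range.mp hk)
      rw [C_mul_X_pow_mul_term', chartTransform_monomial, chartExponent_two hxy hσ, single_add_single_apply_fst hxy,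
        single_add_single_apply_snd hxy, show d x + (d y - k) + k - q = d x + d y - q by omega]
    rw [hL, hR]
  | add F G hF hG =>
    rw [chartTransform_add, translate_add, hF, hG, map_add, chartTransform_add]

end Shear

/-! ## 2. Cleaning commutes with the chart; the step as the chart of the clean sheared expansion -/

section Dictionary

variable {σ : Type*} {K : Type*} [Field K] [DecidableEq σ]

/-- Deleting `q`-th power monomials is additive. [cite: Hauser2010, §I (deleting the p-th power monomials)] -/
theorem deletePthPowers_add (q : ℕ) (P Q : MvPolynomial σ K) :
    deletePthPowers q (P + Q) = deletePthPowers q P + deletePthPowers q Q := by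
  ext d
  simp only [coeff_deletePthPowers, coeff_add]
  split_ifs <;> simp

/-- Deleting `q`-th power monomials from a finite sum. [cite: Hauser2010, §I (deleting the p-th power monomials)] -/
theorem deletePthPowers_sum {ι : Type*} (q : ℕ) (s : Finset ι) (f : ι → MvPolynomial σ K) :
    deletePthPowers q (∑ i ∈ s, f i) = ∑ i ∈ s, deletePthPowers q (f i) := by
  classical
  induction s using Finset.induction_on with
  | empty => simp [deletePthPowers_zero]
  | insert a s ha ih => rw [Finset.sum_insert ha, Finset.sum_insert ha, deletePthPowers_add, ih]

/-- Deleting `q`-th power monomials from a monomial. [cite: Hauser2010, §I (deleting the p-th power monomials)] -/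
theorem deletePthPowers_monomial (q : ℕ) (d : σ →₀ ℕ) (c : K) :
    deletePthPowers q (monomial d c) = if IsPthPowerExponent q d then 0 else monomial d c := by
  ext e
  rw [coeff_deletePthPowers]
  by_cases hd : IsPthPowerExponent q d
  · rw [if_pos hd, coeff_zero, coeff_monomial]
    by_cases hde : d = e
    · subst hde; rw [if_pos hd]
    · rw [if_neg hde]; split_ifs <;> rfl
  · rw [if_neg hd, coeff_monomial]
    by_cases hde : d = e
    · subst hde; rw [if_neg hd]
    · rw [if_neg hde]; split_ifs <;> rfl

variable [Fintype σ]

/-- For `q ≤ a + c` the chart exponent `(a + c − q, c)` is a `q`-th power exponent iff `(a, c)` is.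
[cite: HauserPerlega2024, §6 p. 793 (if t = 0, then the expansion of F′(x,y) is again clean)] -/
theorem isPthPowerExponent_chartExponent_iff {x y : σ} (hxy : x ≠ y) (hσ : ∀ l, l = x ∨ l = y) (q : ℕ)
    {d : σ →₀ ℕ} (hd : q ≤ d.degree) : IsPthPowerExponent q (chartExponent q x d) ↔ IsPthPowerExponent q d := by
  rw [isPthPowerExponent_iff, isPthPowerExponent_iff, chartExponent_two hxy hσ]
  rw [degree_eq_two hxy hσ] at hd
  constructor
  · intro h l
    have hx := h x
    have hy := h y
    rw [single_add_single_apply_fst hxy] at hx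
    rw [single_add_single_apply_snd hxy] at hy
    rcases hσ l with rfl | rfl
    · have h1 : q ∣ d l + d y - q + q := dvd_add hx (dvd_refl q)
      rw [Nat.sub_add_cancel hd] at h1
      exact (Nat.dvd_add_left hy).mp h1
    · exact hy
  · intro h l
    rcases hσ l with rfl | rfl
    · rw [single_add_single_apply_fst hxy]
      exact Nat.dvd_sub (dvd_add (h l) (h y)) (dvd_refl q)
    · rw [single_add_single_apply_snd hxy]
      exact h l

/-- **Cleaning commutes with the chart transform** when no monomial has degree `< q`.
[cite: HauserPerlega2024, §4 p. 779 (F′_t(x,y) = x^{−pᵉ} F_t(x, xy), F_t the cleaned expansion)] -/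
theorem deletePthPowers_chartTransform {x y : σ} (hxy : x ≠ y) (hσ : ∀ l, l = x ∨ l = y) (q : ℕ)
    {G : MvPolynomial σ K} (hG : ∀ d ∈ G.support, q ≤ d.degree) :
    deletePthPowers q (chartTransform q x G) = chartTransform q x (deletePthPowers q G) := by
  conv_lhs => rw [G.as_sum, chartTransform_sum, deletePthPowers_sum]
  conv_rhs => rw [G.as_sum, deletePthPowers_sum, chartTransform_sum]
  refine Finset.sum_congr rfl fun d hd => ?_
  rw [chartTransform_monomial, deletePthPowers_monomial, deletePthPowers_monomial]
  by_cases h : IsPthPowerExponent q d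
  · rw [if_pos h, if_pos ((isPthPowerExponent_chartExponent_iff hxy hσ q (hG d hd)).mpr h), chartTransform_zero]
  · rw [if_neg h, if_neg (fun h' => h ((isPthPowerExponent_chartExponent_iff hxy hσ q (hG d hd)).mp h')),
      chartTransform_monomial]

/-- **The coefficients of the shear** `F(x, y + t·x) = Σ_d c_d Σ_k binom(d_y,k) t^{d_y−k} x^{d_x+d_y−k} y^k`.
[cite: HauserPerlega2024, §4 p. 779 (the change of parameters y_t = y + tx; the expansion of F with respect to x, y_t)] -/
theorem coeff_shear_eq_sum {x y : σ} (hxy : x ≠ y) (hσ : ∀ l, l = x ∨ l = y) (t : K) (F : MvPolynomial σ K)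
    (e : σ →₀ ℕ) :
    coeff e (MvPolynomial.aeval (fun l => if l = y then (X y + C t * X x : MvPolynomial σ K) else X l) F) =
      ∑ d ∈ F.support, ∑ k ∈ Finset.range (d y + 1),
        if Finsupp.single x (d x + (d y - k)) + Finsupp.single y k = e then
          coeff d F * t ^ (d y - k) * ((d y).choose k : ℕ) else 0 := by
  classical
  conv_lhs => rw [F.as_sum, map_sum, coeff_sum]
  refine Finset.sum_congr rfl fun d _ => ?_
  rw [MvPolynomial.aeval_monomial, Finsupp.prod_fintype _ _ (fun i => pow_zero _), prod_letters_two hxy hσ,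
    if_neg hxy, if_pos rfl, MvPolynomial.algebraMap_eq, add_pow]
  simp only [Finset.mul_sum]
  rw [coeff_sum]
  refine Finset.sum_congr rfl fun k _ => ?_
  rw [C_mul_X_pow_mul_term', coeff_monomial]

/-- Every monomial of the shear `F(x, y + t x)` comes from a monomial `x^a y^c` of `F` as `x^{a + c − k} y^k`, `k ≤ c`.
[cite: HauserPerlega2024, §4 p. 779 (the expansion of F with respect to x, y_t)] -/
theorem exists_of_mem_support_shear {x y : σ} (hxy : x ≠ y) (hσ : ∀ l, l = x ∨ l = y) (t : K)
    (F : MvPolynomial σ K) {e : σ →₀ ℕ}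
    (he : e ∈ (MvPolynomial.aeval (fun l => if l = y then (X y + C t * X x : MvPolynomial σ K) else X l) F).support) :
    ∃ d ∈ F.support, ∃ k, k ≤ d y ∧ e = Finsupp.single x (d x + (d y - k)) + Finsupp.single y k := by
  classical
  rw [MvPolynomial.mem_support_iff, coeff_shear_eq_sum hxy hσ] at he
  obtain ⟨d, hd, hne⟩ := Finset.exists_ne_zero_of_sum_ne_zero he
  obtain ⟨k, hk, hne'⟩ := Finset.exists_ne_zero_of_sum_ne_zero hne
  refine ⟨d, hd, k, Nat.lt_succ_iff.mp (Finset.mem_range.mp hk), ?_⟩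
  by_contra hek
  exact hne' (if_neg (fun h => hek h.symm))

/-- The shear `y ↦ y + t·x` preserves total degrees: every monomial of `F(x, y + t x)` has the degree of a monomial of
`F` (with no larger `y`-exponent and no smaller `x`-exponent). [cite: HauserPerlega2024, §4 p. 779 (the expansion of F with respect to x, y_t)] -/
theorem exists_degree_eq_of_mem_support_shear {x y : σ} (hxy : x ≠ y) (hσ : ∀ l, l = x ∨ l = y) (t : K)
    (F : MvPolynomial σ K) {e : σ →₀ ℕ}
    (he : e ∈ (MvPolynomial.aeval (fun l => if l = y then (X y + C t * X x : MvPolynomial σ K) else X l) F).support) :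
    ∃ d ∈ F.support, e.degree = d.degree ∧ d x ≤ e x ∧ e y ≤ d y := by
  obtain ⟨d, hd, k, hk, rfl⟩ := exists_of_mem_support_shear hxy hσ t F he
  refine ⟨d, hd, ?_, ?_, ?_⟩
  · rw [degree_eq_two hxy hσ, degree_eq_two hxy hσ, single_add_single_apply_fst hxy, single_add_single_apply_snd hxy]
    omega
  · rw [single_add_single_apply_fst hxy]; omega
  · rw [single_add_single_apply_snd hxy]; exact hk

/-- **A monomial of `F` with a unique contributor keeps its coefficient under the shear**: if every monomial of `F` of
the same degree as `e` and with `y`-exponent `≥ e_y` is `e` itself, then `[x^{e_x} y^{e_y}] F(x, y + t x) = [x^{e_x} y^{e_y}] F`.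
[cite: HauserPerlega2024, §4 p. 779 (the expansion of F with respect to x, y_t)] -/
theorem coeff_shear_eq_coeff_of_unique {x y : σ} (hxy : x ≠ y) (hσ : ∀ l, l = x ∨ l = y) (t : K)
    (F : MvPolynomial σ K) {e : σ →₀ ℕ}
    (huniq : ∀ d ∈ F.support, d.degree = e.degree → e y ≤ d y → d = e) :
    coeff e (MvPolynomial.aeval (fun l => if l = y then (X y + C t * X x : MvPolynomial σ K) else X l) F) =
      coeff e F := by
  classical
  rw [coeff_shear_eq_sum hxy hσ]
  have hterm : ∀ d ∈ F.support, (∑ k ∈ Finset.range (d y + 1),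
      if Finsupp.single x (d x + (d y - k)) + Finsupp.single y k = e then
        coeff d F * t ^ (d y - k) * ((d y).choose k : ℕ) else 0) = if d = e then coeff d F else 0 := by
    intro d hd
    by_cases hde : d = e
    · rw [if_pos hde, Finset.sum_eq_single (e y)]
      · rw [if_pos (by rw [hde, Nat.sub_self, add_zero]; exact (finsupp_eq_single_add_single hxy hσ e).symm), hde,
          Nat.sub_self, pow_zero, mul_one, Nat.choose_self, Nat.cast_one, mul_one]
      · intro k _ hk
        rw [if_neg]
        intro h
        apply hk
        have := congrArg (fun f => f y) h
        simp only [single_add_single_apply_snd hxy] at this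
        exact this
      · intro h
        exact absurd (Finset.mem_range.mpr (by rw [hde]; omega)) h
    · rw [if_neg hde]
      refine Finset.sum_eq_zero fun k hk => ?_
      rw [if_neg]
      intro h
      have hk' : k ≤ d y := Nat.lt_succ_iff.mp (Finset.mem_range.mp hk)
      have hy := congrArg (fun f => f y) h
      have hx := congrArg (fun f => f x) h
      simp only [single_add_single_apply_snd hxy] at hy
      simp only [single_add_single_apply_fst hxy] at hx
      apply hde
      apply huniq d hd
      · rw [degree_eq_two hxy hσ, degree_eq_two hxy hσ]; omega
      · omega
  rw [Finset.sum_congr rfl hterm, Finset.sum_ite_eq']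
  split_ifs with he
  · rfl
  · exact (MvPolynomial.notMem_support_iff.mp he).symm

/-- **The clean sheared expansion has the order of `F`** (`ord F_t = ord F`): a least-degree monomial of the clean `F`
with the largest `y`-exponent survives the shear with its coefficient, and it is not a `q`-th power.
[cite: HauserPerlega2024, §6 p. 795 (case (ii): "As ord(F) = ord_ω(F)")] -/
theorem ordZero_cleanShear_eq {x y : σ} (hxy : x ≠ y) (hσ : ∀ l, l = x ∨ l = y) (q : ℕ) (t : K)
    {F : MvPolynomial σ K} (hF : F ≠ 0) (hclean : deletePthPowers q F = F) :
    ordZero (deletePthPowers q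
      (MvPolynomial.aeval (fun l => if l = y then (X y + C t * X x : MvPolynomial σ K) else X l) F)) = ordZero F := by
  classical
  obtain ⟨o, ho'⟩ := WithTop.ne_top_iff_exists.mp (show ordZero F ≠ ⊤ by
    unfold ordZero; rw [Ne, MvPowerSeries.order_eq_top_iff, MvPolynomial.coe_eq_zero_iff]; exact hF)
  have ho : ordZero F = o := ho'.symm
  obtain ⟨⟨d₁, hd₁, hd₁deg⟩, hmin⟩ := exists_mem_support_degree_eq ho
  -- a least-degree monomial with the largest `y`-exponent
  set S := F.support.filter (fun d => d.degree = o) with hS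
  have hSne : S.Nonempty := ⟨d₁, Finset.mem_filter.mpr ⟨hd₁, hd₁deg⟩⟩
  obtain ⟨e, heS, hemax⟩ := Finset.exists_max_image S (fun d => d y) hSne
  obtain ⟨he, hedeg⟩ := Finset.mem_filter.mp heS
  have huniq : ∀ d ∈ F.support, d.degree = e.degree → e y ≤ d y → d = e := by
    intro d hd hdeg hy
    have hdy : d y ≤ e y := hemax d (Finset.mem_filter.mpr ⟨hd, by rw [hdeg, hedeg]⟩)
    rw [degree_eq_two hxy hσ, degree_eq_two hxy hσ] at hdeg
    rw [finsupp_eq_single_add_single hxy hσ d, finsupp_eq_single_add_single hxy hσ e]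
    congr 1 <;> congr 1 <;> omega
  rw [ho]
  apply le_antisymm
  · refine ordZero_le_of_coeff_ne_zero _ e ?_ |>.trans (le_of_eq (by rw [hedeg]))
    rw [coeff_deletePthPowers, if_neg (not_isPthPowerExponent_of_clean q hclean he),
      coeff_shear_eq_coeff_of_unique hxy hσ t F huniq]
    exact MvPolynomial.mem_support_iff.mp he
  · refine le_ordZero_of_forall _ o fun e' he' => ?_
    have he'' : e' ∈ (MvPolynomial.aeval
        (fun l => if l = y then (X y + C t * X x : MvPolynomial σ K) else X l) F).support := by
      rw [MvPolynomial.mem_support_iff]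
      intro h0
      apply he'
      rw [coeff_deletePthPowers, h0]
      split_ifs <;> rfl
    obtain ⟨d, hd, hdeg, -, -⟩ := exists_degree_eq_of_mem_support_shear hxy hσ t F he''
    rw [hdeg]
    exact hmin d hd

variable [DecidableEq K]

/-- **The translated step is the chart transform of the clean sheared expansion**: for `q ≤ ord F` and the point
`b = (0, t)` of the `x`-chart, `(step q x b s).F = chartTransform q x F₀` with `F₀ = deletePthPowers q (F(x, y + t x))`
("`F′_t(x, y) = x^{−pᵉ} F_t(x, xy)`"). [cite: HauserPerlega2024, §4 p. 779] -/
theorem step_F_eq_chartTransform_clean_shear {x y : σ} (hxy : x ≠ y) (hσ : ∀ l, l = x ∨ l = y) (q : ℕ)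
    (b : σ → K) (hbx : b x = 0) (s : State σ K) (hq : (q : ℕ∞) ≤ ordZero s.F) :
    (step q x b s).F = chartTransform q x (deletePthPowers q
      (MvPolynomial.aeval (fun l => if l = y then (X y + C (b y) * X x : MvPolynomial σ K) else X l) s.F)) := by
  change deletePthPowers q (translate b (chartTransform q x s.F)) = _
  rw [translate_chartTransform_eq_chartTransform_shear hxy hσ q b hbx,
    deletePthPowers_chartTransform hxy hσ q]
  intro e he
  obtain ⟨d, hd, hdeg, -, -⟩ := exists_degree_eq_of_mem_support_shear hxy hσ (b y) s.F he
  rw [hdeg]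
  have h1 := ordZero_le_of_coeff_ne_zero s.F d (MvPolynomial.mem_support_iff.mp hd)
  exact_mod_cast hq.trans h1

omit [Fintype σ] [DecidableEq K] in
/-- Deleting `q`-th power monomials: the series-level `cleanSeries` of a polynomial is (the coercion of)
`deletePthPowers`. [cite: HauserPerlega2024, §5 p. 783 (clean expansion; the cleaning deletes the pᵉ-th power monomials)] -/
theorem cleanSeries_coe (q : ℕ) (P : MvPolynomial σ K) :
    cleanSeries q (P : MvPowerSeries σ K) = ((deletePthPowers q P : MvPolynomial σ K) : MvPowerSeries σ K) := by
  ext d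
  rw [MvPolynomial.coeff_coe, coeff_deletePthPowers, MvPowerSeries.coeff_apply, cleanSeries_apply']
  have hc : (P : MvPowerSeries σ K) d = coeff d P :=
    (MvPowerSeries.coeff_apply (P : MvPowerSeries σ K) d).symm.trans (MvPolynomial.coeff_coe _ _)
  rw [hc]
  by_cases h : IsPthPowerExponent q d
  · rw [if_pos h, if_pos ((isPthPowerExponent_iff q d).mp h)]
  · rw [if_neg h, if_neg (fun h' => h ((isPthPowerExponent_iff q d).mpr h'))]

omit [Fintype σ] [DecidableEq K] in
/-- The shear as a power series: `substFree x y (t·X) F = F(x, y + t·x)`. [cite: HauserWagner2014, §4 Remark 4 (triangular subordinate change y ↦ y + φ(x)); HauserPerlega2024, §4 p. 779 (y_t = y + tx)] -/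
theorem substFree_smul_X_eq_coe (x y : σ) (t : K) (F : MvPolynomial σ K) :
    substFree x y (t • PowerSeries.X) F =
      ((MvPolynomial.aeval (fun l => if l = y then (X y + C t * X x : MvPolynomial σ K) else X l) F :
        MvPolynomial σ K) : MvPowerSeries σ K) := by
  unfold substFree
  rw [MvPowerSeries.subst_coe, PowerSeries.subst_smul (PowerSeries.HasSubst.X x),
    PowerSeries.subst_X (PowerSeries.HasSubst.X x)]
  have hφ : ∀ P : MvPolynomial σ K, ((P : MvPolynomial σ K) : MvPowerSeries σ K) =
      MvPolynomial.coeToMvPowerSeries.algHom K P := fun P => by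
    rw [MvPolynomial.coeToMvPowerSeries.algHom_apply, Algebra.algebraMap_self, MvPowerSeries.map_id]
    rfl
  have hfun : (fun l => if l = y then (MvPowerSeries.X y + t • MvPowerSeries.X x : MvPowerSeries σ K)
      else MvPowerSeries.X l) = fun l => MvPolynomial.coeToMvPowerSeries.algHom K
        (if l = y then (X y + C t * X x : MvPolynomial σ K) else X l) := by
    funext l
    split_ifs
    · rw [← hφ, MvPolynomial.coe_add, MvPolynomial.coe_mul, MvPolynomial.coe_C, MvPolynomial.coe_X,
        MvPolynomial.coe_X, MvPowerSeries.smul_eq_C_mul]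
    · rw [← hφ, MvPolynomial.coe_X]
  rw [hfun, ← MvPolynomial.comp_aeval, AlgHom.comp_apply, ← hφ]

omit [DecidableEq K] in
omit [Fintype σ] [DecidableEq K] in
/-- **The clean sheared expansion is the clean expansion of the flag `Φ_t = ⟨y, x, −t·X⟩`** (`y_t = y + t x`,
`F₁ = V(z_t, y_t)`): `Φ_t.expansion q F = F₀`. [cite: HauserPerlega2024, §4 p. 779 (f = z_t^{pᵉ} + F_t(x, y_t), the cleaned expansion)] -/
theorem expansion_shearFlag_eq_coe (x y : σ) (q : ℕ) (t : K) (F : MvPolynomial σ K) :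
    FlagDatum.expansion ⟨y, x, (-t) • PowerSeries.X⟩ q F = ((deletePthPowers q
      (MvPolynomial.aeval (fun l => if l = y then (X y + C t * X x : MvPolynomial σ K) else X l) F) :
        MvPolynomial σ K) : MvPowerSeries σ K) := by
  change cleanSeries q (substFree x y (-((-t) • PowerSeries.X)) F) = _
  rw [neg_smul, neg_neg, substFree_smul_X_eq_coe x y, cleanSeries_coe]

end Dictionary

/-! ## 3. Orders of the chart transform: `ord_x F′ = ord F₀ − q` and FIGURE 1 (`d′_res ≤ d_t`) -/

section Orders

variable {σ : Type*} {K : Type*} [Field K] [DecidableEq σ]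

omit [DecidableEq σ] in
/-- `ordVar_i G ≤ d_i` on the support. [cite: HauserWagner2014, §4 p. 186 (Order_y F)] -/
theorem ordVar_le_of_mem_support {G : MvPolynomial σ K} {d : σ →₀ ℕ} (hd : d ∈ G.support) (i : σ) :
    ordVar G i ≤ d i := by
  unfold ordVar bigH
  exact ENat.toNat_le_of_le_coe (Finset.inf_le hd)

omit [DecidableEq σ] in
/-- `ordVar_i G` is attained on the support of a non-zero polynomial. [cite: HauserWagner2014, §4 p. 186 (Order_y F)] -/
theorem exists_mem_support_apply_eq_ordVar {G : MvPolynomial σ K} (hG : G ≠ 0) (i : σ) :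
    ∃ d ∈ G.support, d i = ordVar G i := by
  have hne : G.support.Nonempty := MvPolynomial.support_nonempty.mpr hG
  obtain ⟨d, hd, hinf⟩ := Finset.exists_mem_eq_inf G.support hne (fun d => ((d i : ℕ) : ℕ∞))
  refine ⟨d, hd, ?_⟩
  unfold ordVar bigH
  rw [hinf, ENat.toNat_coe]

omit [DecidableEq σ] in
/-- a lower bound on the `i`-exponents of the support bounds `ordVar_i` from below. [cite: HauserWagner2014, §4 p. 186 (Order_y F)] -/
theorem le_ordVar_of_forall {G : MvPolynomial σ K} (hG : G ≠ 0) (i : σ) {m : ℕ}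
    (h : ∀ d ∈ G.support, m ≤ d i) : m ≤ ordVar G i := by
  obtain ⟨d, hd, hdi⟩ := exists_mem_support_apply_eq_ordVar hG i
  rw [← hdi]
  exact h d hd

omit [DecidableEq σ] in
/-- `d_res` only decreases when exceptional letters are added. [cite: HauserPerlega2024, §4 p. 776 (d_res = ord F − ord_{E_a} F)] -/
theorem dRes_mono {E E' : Finset σ} (h : E ⊆ E') (G : MvPolynomial σ K) : dRes E' G ≤ dRes E G := by
  unfold dRes
  exact Nat.sub_le_sub_left (Finset.sum_le_sum_of_subset h) _

omit [DecidableEq σ] in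
/-- `d_res` for a single exceptional letter. [cite: HauserPerlega2024, §4 p. 776 (d_res = ord F − ord_{E_a} F)] -/
theorem dRes_singleton (i : σ) (G : MvPolynomial σ K) : dRes {i} G = (ordZero G).toNat - ordVar G i := by
  unfold dRes
  rw [Finset.sum_singleton]

variable [Fintype σ]

omit [Fintype σ] in
/-- The chart transform is the package transform of length one. [cite: HauserPerlega2024, §4 p. 781 (the first n − 1 blowups … the last blowup)] -/
theorem chartTransform_eq_pkgTransform_one (q : ℕ) (j : σ) (G : MvPolynomial σ K) :
    chartTransform q j G = pkgTransform q j 1 G := by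
  unfold chartTransform pkgTransform
  refine Finset.sum_congr rfl fun d _ => ?_
  rw [show chartExponent q j d = pkgExponent q j 1 d from by
    ext k; rw [chartExponent_apply, pkgExponent_apply, pkgWeight_one, one_mul]]

/-- The exponent of a monomial of `G` is carried to a monomial of the chart transform with the same coefficient
(no truncation). [cite: Hauser2010, §F (chart expressions of a point blowup)] -/
theorem coeff_chartExponent_chartTransform (q : ℕ) (j : σ) {G : MvPolynomial σ K}
    (hG : ∀ d ∈ G.support, q ≤ d.degree) {d : σ →₀ ℕ} (hd : d ∈ G.support) :
    coeff (chartExponent q j d) (chartTransform q j G) = coeff d G := by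
  have hG1 : ∀ d ∈ G.support, 1 * q ≤ pkgWeight j 1 d := fun d hd => by rw [one_mul, pkgWeight_one]; exact hG d hd
  have := coeff_pkgTransform hG1 hd
  rwa [← chartTransform_eq_pkgTransform_one, show pkgExponent q j 1 d = chartExponent q j d by
    ext k; rw [chartExponent_apply, pkgExponent_apply, pkgWeight_one, one_mul]] at this

/-- The support of the chart transform is the image of the support (no truncation). [cite: Hauser2010, §F (chart expressions of a point blowup)] -/
theorem support_chartTransform (q : ℕ) (j : σ) {G : MvPolynomial σ K} (hG : ∀ d ∈ G.support, q ≤ d.degree) :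
    (chartTransform q j G).support = G.support.image (chartExponent q j) := by
  have hG1 : ∀ d ∈ G.support, 1 * q ≤ pkgWeight j 1 d := fun d hd => by rw [one_mul, pkgWeight_one]; exact hG d hd
  rw [chartTransform_eq_pkgTransform_one, support_pkgTransform hG1]
  congr 1
  funext d
  ext k
  rw [chartExponent_apply, pkgExponent_apply, pkgWeight_one, one_mul]

/-- The chart transform of a non-zero polynomial (no truncation) is non-zero. [cite: Hauser2010, §F (chart expressions of a point blowup)] -/
theorem chartTransform_ne_zero (q : ℕ) (j : σ) {G : MvPolynomial σ K} (hG0 : G ≠ 0)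
    (hG : ∀ d ∈ G.support, q ≤ d.degree) : chartTransform q j G ≠ 0 := by
  obtain ⟨d, hd⟩ := MvPolynomial.ne_zero_iff.mp hG0
  rw [MvPolynomial.ne_zero_iff]
  refine ⟨chartExponent q j d, ?_⟩
  rw [coeff_chartExponent_chartTransform q j hG (MvPolynomial.mem_support_iff.mpr hd)]
  exact hd

/-- **`ord_x F′ = ord F₀ − q`**: the order along the new exceptional component `{x = 0}` of the chart transform.
[cite: HauserPerlega2024, §4 p. 779 (d′_res = ord_{a′} F′_t − ord_{V(x)} F′_t)] -/
theorem ordVar_chartTransform_self {x y : σ} (hxy : x ≠ y) (hσ : ∀ l, l = x ∨ l = y) (q : ℕ)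
    {G : MvPolynomial σ K} (hG0 : G ≠ 0) {o : ℕ} (ho : ordZero G = o) (hq : q ≤ o) :
    ordVar (chartTransform q x G) x = o - q := by
  obtain ⟨⟨d₀, hd₀, hd₀deg⟩, hmin⟩ := exists_mem_support_degree_eq ho
  have hG : ∀ d ∈ G.support, q ≤ d.degree := fun d hd => hq.trans (hmin d hd)
  apply le_antisymm
  · have hmem : chartExponent q x d₀ ∈ (chartTransform q x G).support := by
      rw [support_chartTransform q x hG]; exact Finset.mem_image_of_mem _ hd₀
    refine (ordVar_le_of_mem_support hmem x).trans (le_of_eq ?_)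
    rw [chartExponent_two hxy hσ, single_add_single_apply_fst hxy, ← degree_eq_two hxy hσ, hd₀deg]
  · refine le_ordVar_of_forall (chartTransform_ne_zero q x hG0 hG) x fun e he => ?_
    rw [support_chartTransform q x hG, Finset.mem_image] at he
    obtain ⟨d, hd, rfl⟩ := he
    rw [chartExponent_two hxy hσ, single_add_single_apply_fst hxy, ← degree_eq_two hxy hσ]
    exact Nat.sub_le_sub_right (hmin d hd) q

/-- **FIGURE 1: `d′_res ≤ d_t`.** For a monomial `x^{o − j} y^{j}` of least degree `o` of `F₀` (`q ≤ o`), the residual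
order of the chart transform with respect to the new component `{x = 0}` is at most `j`: the chart carries it to
`x^{o − q} y^{j}`, of degree `(o − q) + j`, while `ord_x F′ = o − q`. (Applied to the least such `j`, `d_t =
ord_{(y_t)} in(F₀)`, this is the printed "We see that the inequality `d′_res ≤ d_t` holds".)
[cite: HauserPerlega2024, §4 p. 780 (Figure 1; d′_res ≤ d_t)] -/
theorem dRes_chartTransform_le {x y : σ} (hxy : x ≠ y) (hσ : ∀ l, l = x ∨ l = y) (q : ℕ)
    {G : MvPolynomial σ K} {o : ℕ} (ho : ordZero G = o) (hq : q ≤ o) {d₀ : σ →₀ ℕ} (hd₀ : d₀ ∈ G.support)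
    (hd₀deg : d₀.degree = o) : dRes {x} (chartTransform q x G) ≤ d₀ y := by
  have hG0 : G ≠ 0 := MvPolynomial.ne_zero_iff.mpr ⟨d₀, MvPolynomial.mem_support_iff.mp hd₀⟩
  obtain ⟨-, hmin⟩ := exists_mem_support_degree_eq ho
  have hG : ∀ d ∈ G.support, q ≤ d.degree := fun d hd => hq.trans (hmin d hd)
  rw [dRes_singleton, ordVar_chartTransform_self hxy hσ q hG0 ho hq]
  have hcoeff : coeff (chartExponent q x d₀) (chartTransform q x G) ≠ 0 := by
    rw [coeff_chartExponent_chartTransform q x hG hd₀]; exact MvPolynomial.mem_support_iff.mp hd₀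
  have h1 := ordZero_le_of_coeff_ne_zero _ _ hcoeff
  rw [chartExponent_two hxy hσ, degree_eq_two hxy hσ, single_add_single_apply_fst hxy,
    single_add_single_apply_snd hxy, ← degree_eq_two hxy hσ, hd₀deg] at h1
  have h2 := ENat.toNat_le_of_le_coe h1
  omega

omit [DecidableEq σ] [Fintype σ] in
/-- **`d_t` as a minimum over the initial monomials.** For a non-zero polynomial `P` of order `o`, `ord_{(y)} in(P)`
(the series-level `ordAlong y (initialPart 𝟙 P)` of `PointBlowupFlagInvariant`, i.e. `d^curv` of a flag with `n = 1`)
is the least `y`-exponent of a monomial of `P` of degree `o`, and it is attained.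
[cite: HauserPerlega2024, §4 p. 780 (d_t the order of in(F_t) along the curve V(z, y))] -/
theorem exists_mem_support_apply_eq_ordAlong_initialPart (y : σ) {P : MvPolynomial σ K} {o : ℕ}
    (ho : ordZero P = o) :
    (∃ d₀ ∈ P.support, d₀.degree = o ∧
      ((d₀ y : ℕ) : ℕ∞) = ordAlong y (initialPart (fun _ => (1 : ℕ)) (P : MvPowerSeries σ K))) ∧
    ∀ d ∈ P.support, d.degree = o →
      ordAlong y (initialPart (fun _ => (1 : ℕ)) (P : MvPowerSeries σ K)) ≤ ((d y : ℕ) : ℕ∞) := by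
  obtain ⟨⟨d₁, hd₁, hd₁deg⟩, -⟩ := exists_mem_support_degree_eq ho
  have hwo : wOrder (fun _ => (1 : ℕ)) (P : MvPowerSeries σ K) = o := ho
  have hin : ∀ d : σ →₀ ℕ, initialPart (fun _ => (1 : ℕ)) (P : MvPowerSeries σ K) d ≠ 0 ↔
      d ∈ P.support ∧ d.degree = o := by
    intro d
    rw [initialPart_apply', hwo, MvPolynomial.mem_support_iff]
    have hw : Finsupp.weight (fun _ => (1 : ℕ)) d = d.degree := by rw [Finsupp.degree_eq_weight_one]
    rw [hw]
    constructor
    · intro h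
      by_cases hdeg : ((d.degree : ℕ) : ℕ∞) = (o : ℕ∞)
      · rw [if_pos hdeg] at h
        exact ⟨fun h0 => h (by rw [← MvPolynomial.coeff_coe, MvPowerSeries.coeff_apply] at h0; exact h0),
          by exact_mod_cast hdeg⟩
      · rw [if_neg hdeg] at h; exact (h rfl).elim
    · rintro ⟨h, hdeg⟩
      rw [if_pos (by exact_mod_cast hdeg)]
      rwa [← MvPolynomial.coeff_coe, MvPowerSeries.coeff_apply] at h
  set S := P.support.filter (fun d => d.degree = o) with hS
  have hSne : S.Nonempty := ⟨d₁, Finset.mem_filter.mpr ⟨hd₁, hd₁deg⟩⟩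
  obtain ⟨d₀, hd₀S, hinf⟩ := Finset.exists_mem_eq_inf S hSne (fun d => ((d y : ℕ) : ℕ∞))
  obtain ⟨hd₀, hd₀deg⟩ := Finset.mem_filter.mp hd₀S
  have heq : ordAlong y (initialPart (fun _ => (1 : ℕ)) (P : MvPowerSeries σ K)) =
      S.inf (fun d => ((d y : ℕ) : ℕ∞)) := by
    unfold ordAlong
    apply le_antisymm
    · refine Finset.le_inf fun d hd => iInf₂_le d ((hin d).mpr (Finset.mem_filter.mp hd))
    · exact le_iInf₂ fun d hd => Finset.inf_le (Finset.mem_filter.mpr ((hin d).mp hd))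
  refine ⟨⟨d₀, hd₀, hd₀deg, by rw [heq, hinf]⟩, fun d hd hdeg => ?_⟩
  rw [heq]
  exact Finset.inf_le (Finset.mem_filter.mpr ⟨hd, hdeg⟩)


/-- **The clean sheared expansion has the same order along `{x = 0}` as `F`** (`ord_x F_t = ord_x F`): a monomial of
`F` with the least `x`-exponent keeps its coefficient under the shear and is not a `q`-th power; the shear only raises
`x`-exponents. [cite: HauserPerlega2024, §4 p. 779 (the residual order does not depend on the choice of subordinate parameters; here only its x-part is needed)] -/
theorem ordVar_cleanShear_self {x y : σ} (hxy : x ≠ y) (hσ : ∀ l, l = x ∨ l = y) (q : ℕ) (t : K)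
    {F : MvPolynomial σ K} (hF : F ≠ 0) (hclean : deletePthPowers q F = F) :
    ordVar (deletePthPowers q
      (MvPolynomial.aeval (fun l => if l = y then (X y + C t * X x : MvPolynomial σ K) else X l) F)) x = ordVar F x := by
  classical
  set F₀ := deletePthPowers q
      (MvPolynomial.aeval (fun l => if l = y then (X y + C t * X x : MvPolynomial σ K) else X l) F) with hF₀
  obtain ⟨e, he, hex⟩ := exists_mem_support_apply_eq_ordVar hF x
  have huniq : ∀ d ∈ F.support, d.degree = e.degree → e y ≤ d y → d = e := by
    intro d hd hdeg hy
    have hdx : e x ≤ d x := by rw [hex]; exact ordVar_le_of_mem_support hd x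
    rw [degree_eq_two hxy hσ, degree_eq_two hxy hσ] at hdeg
    rw [finsupp_eq_single_add_single hxy hσ d, finsupp_eq_single_add_single hxy hσ e]
    congr 1 <;> congr 1 <;> omega
  have heF₀ : e ∈ F₀.support := by
    rw [MvPolynomial.mem_support_iff, hF₀, coeff_deletePthPowers,
      if_neg (not_isPthPowerExponent_of_clean q hclean he), coeff_shear_eq_coeff_of_unique hxy hσ t F huniq]
    exact MvPolynomial.mem_support_iff.mp he
  have hF₀ne : F₀ ≠ 0 := MvPolynomial.ne_zero_iff.mpr ⟨e, MvPolynomial.mem_support_iff.mp heF₀⟩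
  apply le_antisymm
  · rw [← hex]; exact ordVar_le_of_mem_support heF₀ x
  · refine le_ordVar_of_forall hF₀ne x fun e' he' => ?_
    have he'' : e' ∈ (MvPolynomial.aeval
        (fun l => if l = y then (X y + C t * X x : MvPolynomial σ K) else X l) F).support := by
      rw [MvPolynomial.mem_support_iff]
      intro h0
      apply MvPolynomial.mem_support_iff.mp he'
      rw [hF₀, coeff_deletePthPowers, h0]
      split_ifs <;> rfl
    obtain ⟨d, hd, -, hdx, -⟩ := exists_degree_eq_of_mem_support_shear hxy hσ t F he''
    exact (ordVar_le_of_mem_support hd x).trans hdx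

end Orders

end HauserPerlega2024

end Literature.AlgebraicGeometry.Resolution

end
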